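import Mathlib
import HarnessLib
import Summits.CriticalPhenomena.CardyFormulaZ2.Theses.CardySelfDualSegment
import Literature.Probability.Percolation.CornerPercolation
import Summits.CriticalPhenomena.CardyFormulaZ2.Theorems.CardySelfDualSegmentSegmentOpenStubCrossingProbPolynomial
import Summits.CriticalPhenomena.CardyFormulaZ2.Theorems.CardySelfDualSegmentSegmentOpenCruxIffNoIsolated

/-!
# Crux `SegmentOpen` (stmt-CriticalPhenomena-5471), line `Sketch` — S4 proves the crux HYPOTHESIS

Kernel-checked record (lead c3) of a structural fact about line `Sketch` that so far lived only in
prose (`Cruxes/SegmentOpen/Disproof.lean` §5(i): "UA ⊢ UM by Cauchy estimates"):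

* `uniformMarginalityShape_of_uniformComplexBound`: the line's non-perturbative stub S4
  (`stub_uniformComplexBound`, verbatim its registered signature, taken as a HYPOTHESIS — not
  claimed) together with the LANDED S1 (`stub_crossingProbPolynomial`, p97364) implies the
  UniformMarginality SHAPE: for every conformal rectangle `R` the crossing curves
  `t ↦ P_t(R, δ)`, `δ > 0`, are equicontinuous at every `t₀` (indeed equi-Lipschitz: Schwarz's
  lemma on the uniform disc `B(t₀, r)` gives `|P_t − P_{t₀}| ≤ (2C/r)|t − t₀|`).
* `uniformMarginality_of_uniformComplexBound`: hence S4 implies the ROUTE DECL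
  `UniformMarginality` of crux stmt-CriticalPhenomena-5472 (its `let` blocks are `cornerParam`,
  `cornerConfig`, `cornerCrossingProb` syntactically) — a proof of S4 would close 5472 as well.
* Consequently, inside line `Sketch` the crux hypothesis is idle: given S4, `SegmentOpen`
  (`UM → IsOpen G`) is equivalent to the UNCONDITIONAL openness of the good set
  (`segmentOpen_iff_isOpen_goodSet_of_uniformComplexBound`) and to the UNCONDITIONAL absence of
  isolated good points (`segmentOpen_iff_noIsolated_of_uniformComplexBound`, from the landed census
  equivalence `stub_segmentOpen_iff_noIsolatedGoodPoint`, p130613).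

Reading for the planners: the two open stubs of line `Sketch` are S4 ⊢ UM (so S4 is at least as
hard as crux 5472, itself held behind UniformBoxCrossing 5476) and S6 ≡ the crux modulo S4.
-/

noncomputable section

namespace Summit.CriticalPhenomena.CardyFormulaZ2.Theorems

open Literature.Probability Literature.Barriers.CriticalPhenomena
open Literature.Probability.RandomPlanarGeometry (ConformalRectangle ConformalEquiv MarkedDomain)
open Filter Set Topology

namespace UAImpliesUM

/-- Schwarz-lemma form of the Cauchy estimate: a holomorphic function bounded by `C` on the disc
`B(c, r)` moves by at most `(2C/r)·|z − c|` from its value at the centre. -/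
theorem dist_le_of_norm_le_on_ball {f : ℂ → ℂ} {c : ℂ} {r C : ℝ}
    (hd : DifferentiableOn ℂ f (Metric.ball c r)) (hC : ∀ z ∈ Metric.ball c r, ‖f z‖ ≤ C)
    {z : ℂ} (hz : z ∈ Metric.ball c r) : dist (f z) (f c) ≤ 2 * C / r * dist z c := by
  have hr : 0 < r := Metric.nonempty_ball.1 ⟨z, hz⟩
  have hmaps : MapsTo f (Metric.ball c r) (Metric.closedBall (f c) (2 * C)) := by
    intro w hw
    rw [Metric.mem_closedBall, dist_eq_norm]
    calc ‖f w - f c‖ ≤ ‖f w‖ + ‖f c‖ := norm_sub_le _ _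
      _ ≤ C + C := add_le_add (hC w hw) (hC c (Metric.mem_ball_self hr))
      _ = 2 * C := by ring
  exact Complex.dist_le_div_mul_dist_of_mapsTo_ball hd hmaps hz

/-- The embedding `ℝ → ℂ` is an isometry. -/
theorem dist_ofReal_ofReal (s c : ℝ) : dist (s : ℂ) (c : ℂ) = dist s c :=
  Complex.isometry_ofReal.dist_eq s c

end UAImpliesUM

open UAImpliesUM in
/-- **S1 ∧ S4 ⊢ the UniformMarginality shape (equicontinuity in `t`, uniform in the mesh).**
Assume S4 (hypothesis `h4`, verbatim the registered stub `stub_uniformComplexBound`; NOT claimed):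
around each `t₀` there is one complex radius `r` such that for every conformal rectangle `R` the
crossing polynomials are bounded by some `C(R)` on `B(t₀, r)`, for all meshes.  Then for every
`R` and `ε > 0` there is `η > 0` with `|P_t(R, δ) − P_{t₀}(R, δ)| < ε` for all `t` with
`dist t t₀ < η` and ALL `δ > 0`.  Proof: by S1 (`stub_crossingProbPolynomial`, landed) `P_·(R, δ)`
is the real trace of a polynomial bounded by `C` on the disc, and Schwarz's lemma at the centre
`t₀` gives the equi-Lipschitz bound `|P_t − P_{t₀}| ≤ (2 max(C,0) / r) |t − t₀|`. -/
theorem uniformMarginalityShape_of_uniformComplexBound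
    (h4 : ∀ t₀ : unitInterval, ∃ r > 0, ∀ R : ConformalRectangle, ∃ C : ℝ, ∀ δ : ℝ, 0 < δ →
      ∀ p : Polynomial ℝ,
        (∀ t : unitInterval, Percolation.cornerCrossingProb t R δ = p.eval (t : ℝ)) →
        ∀ z ∈ Metric.ball ((t₀ : ℝ) : ℂ) r, ‖(p.map (algebraMap ℝ ℂ)).eval z‖ ≤ C) :
    ∀ (t₀ : unitInterval) (R : ConformalRectangle) (ε : ℝ), 0 < ε → ∃ η > 0,
      ∀ t : unitInterval, dist t t₀ < η → ∀ δ : ℝ, 0 < δ →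
        |Percolation.cornerCrossingProb t R δ - Percolation.cornerCrossingProb t₀ R δ| < ε := by
  intro t₀ R ε hε
  obtain ⟨r, hr, hR⟩ := h4 t₀
  obtain ⟨C, hC⟩ := hR R
  -- the equi-Lipschitz constant on the disc
  set K : ℝ := 2 * max C 0 / r with hK
  have hK0 : 0 ≤ K := by
    rw [hK]
    exact div_nonneg (mul_nonneg zero_le_two (le_max_right _ _)) hr.le
  refine ⟨min r (ε / (K + 1)), lt_min hr (div_pos hε (by linarith)), ?_⟩
  intro t ht δ hδ
  obtain ⟨p, hp⟩ := stub_crossingProbPolynomial R δ hδ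
  -- the holomorphic extension and its bound on the disc
  set f : ℂ → ℂ := fun z => (p.map (algebraMap ℝ ℂ)).eval z
  have hd : DifferentiableOn ℂ f (Metric.ball ((t₀ : ℝ) : ℂ) r) :=
    (Polynomial.differentiable _).differentiableOn
  have hCf : ∀ z ∈ Metric.ball ((t₀ : ℝ) : ℂ) r, ‖f z‖ ≤ max C 0 :=
    fun z hz => (hC δ hδ p hp z hz).trans (le_max_left _ _)
  -- the real parameter `t` inside the disc
  have hdist : dist ((t : ℝ) : ℂ) ((t₀ : ℝ) : ℂ) = dist t t₀ := by
    rw [dist_ofReal_ofReal, Subtype.dist_eq]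
  have hz : ((t : ℝ) : ℂ) ∈ Metric.ball ((t₀ : ℝ) : ℂ) r :=
    Metric.mem_ball.2 (hdist ▸ lt_of_lt_of_le ht (min_le_left _ _))
  have hle := dist_le_of_norm_le_on_ball hd hCf hz
  -- `f ↑↑t = P_t(R, δ)` and `f ↑↑t₀ = P_{t₀}(R, δ)` (a real polynomial mapped to `ℂ`,
  -- evaluated at a real point, is the real evaluation)
  have heval : ∀ x : ℝ, f (x : ℂ) = ((p.eval x : ℝ) : ℂ) := fun x => by
    change (p.map (algebraMap ℝ ℂ)).eval (algebraMap ℝ ℂ x) = algebraMap ℝ ℂ (p.eval x)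
    rw [Polynomial.eval_map, Polynomial.eval₂_at_apply]
  have hft : f ((t : ℝ) : ℂ) = ((Percolation.cornerCrossingProb t R δ : ℝ) : ℂ) := by
    rw [heval, ← hp t]
  have hft₀ : f ((t₀ : ℝ) : ℂ) = ((Percolation.cornerCrossingProb t₀ R δ : ℝ) : ℂ) := by
    rw [heval, ← hp t₀]
  rw [hft, hft₀, dist_ofReal_ofReal, Real.dist_eq, hdist] at hle
  -- `K · dist t t₀ < ε`
  have hlt : dist t t₀ < ε / (K + 1) := lt_of_lt_of_le ht (min_le_right _ _)
  calc |Percolation.cornerCrossingProb t R δ - Percolation.cornerCrossingProb t₀ R δ|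
      ≤ 2 * max C 0 / r * dist t t₀ := hle
    _ = K * dist t t₀ := by rw [hK]
    _ ≤ K * (ε / (K + 1)) := mul_le_mul_of_nonneg_left hlt.le hK0
    _ < ε := by
        rw [mul_div_assoc']
        rw [div_lt_iff₀ (by linarith)]
        nlinarith

/-- **S4 ⊢ crux `UniformMarginality` (stmt-CriticalPhenomena-5472).**  The route decl
`UniformMarginality` is, after `zeta`-reducing its `let` blocks (`prm = cornerParam`,
`cfg = cornerConfig`, `P = cornerCrossingProb` syntactically), the UniformMarginality shape over
`cornerCrossingProb`; so S4 (hypothesis, verbatim `stub_uniformComplexBound`) proves it.  A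
conditional result: nothing is claimed about S4. -/
theorem uniformMarginality_of_uniformComplexBound :
    (∀ t₀ : unitInterval, ∃ r > 0, ∀ R : ConformalRectangle, ∃ C : ℝ, ∀ δ : ℝ, 0 < δ →
      ∀ p : Polynomial ℝ,
        (∀ t : unitInterval, Percolation.cornerCrossingProb t R δ = p.eval (t : ℝ)) →
        ∀ z ∈ Metric.ball ((t₀ : ℝ) : ℂ) r, ‖(p.map (algebraMap ℝ ℂ)).eval z‖ ≤ C) →
    Summit.CriticalPhenomena.CardyFormulaZ2.Theses.CardySelfDualSegment.UniformMarginality :=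
  fun h4 => uniformMarginalityShape_of_uniformComplexBound h4

/-- The crux hypothesis of `SegmentOpen` IS the route decl `UniformMarginality` (both are the same
`let`-expanded term): `SegmentOpen ↔ (UniformMarginality → IsOpen G)`. -/
theorem segmentOpen_iff_uniformMarginality_imp :
    Summit.CriticalPhenomena.CardyFormulaZ2.Theses.CardySelfDualSegment.SegmentOpen ↔
      (Summit.CriticalPhenomena.CardyFormulaZ2.Theses.CardySelfDualSegment.UniformMarginality →
        IsOpen {t : unitInterval | ∃ α : ℂ, 0 < α.im ∧
          ∀ (R R' : ConformalRectangle)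
            (φ : ConformalEquiv UpperHalfPlane.upperHalfPlaneSet R.carrier) (x : Fin 4 → ℝ),
            R.carrier = moduliShear α '' R'.carrier → (∀ i, R.pt i = moduliShear α (R'.pt i)) →
            R.IsUniformizing φ x →
            Tendsto (Percolation.cornerCrossingProb t R') (𝓝[>] 0)
              (𝓝 (RandomPlanarGeometry.cardyFunction (RandomPlanarGeometry.crossRatio x)))}) :=
  Iff.rfl

/-- **Given S4 the crux hypothesis is idle: `SegmentOpen ↔ IsOpen G` unconditionally.**  Under
the hypothesis S4 (verbatim `stub_uniformComplexBound`; NOT claimed) the route's `SegmentOpen`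
(`UniformMarginality → IsOpen G`) is equivalent to the bare openness of the good set
`G = {t | ∃ α, 0 < im α ∧ CardyMod t α}`, because S4 already proves `UniformMarginality`
(`uniformMarginality_of_uniformComplexBound`). -/
theorem segmentOpen_iff_isOpen_goodSet_of_uniformComplexBound
    (h4 : ∀ t₀ : unitInterval, ∃ r > 0, ∀ R : ConformalRectangle, ∃ C : ℝ, ∀ δ : ℝ, 0 < δ →
      ∀ p : Polynomial ℝ,
        (∀ t : unitInterval, Percolation.cornerCrossingProb t R δ = p.eval (t : ℝ)) →
        ∀ z ∈ Metric.ball ((t₀ : ℝ) : ℂ) r, ‖(p.map (algebraMap ℝ ℂ)).eval z‖ ≤ C) :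
    Summit.CriticalPhenomena.CardyFormulaZ2.Theses.CardySelfDualSegment.SegmentOpen ↔
      IsOpen {t : unitInterval | ∃ α : ℂ, 0 < α.im ∧
        ∀ (R R' : ConformalRectangle)
          (φ : ConformalEquiv UpperHalfPlane.upperHalfPlaneSet R.carrier) (x : Fin 4 → ℝ),
          R.carrier = moduliShear α '' R'.carrier → (∀ i, R.pt i = moduliShear α (R'.pt i)) →
          R.IsUniformizing φ x →
          Tendsto (Percolation.cornerCrossingProb t R') (𝓝[>] 0)
            (𝓝 (RandomPlanarGeometry.cardyFunction (RandomPlanarGeometry.crossRatio x)))} := by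
  rw [segmentOpen_iff_uniformMarginality_imp]
  exact ⟨fun h => h (uniformMarginality_of_uniformComplexBound h4), fun h _ => h⟩

/-- **Given S4, `SegmentOpen` ↔ "no good point is isolated", with NO marginality hypothesis.**
Combines the landed census equivalence `stub_segmentOpen_iff_noIsolatedGoodPoint` (p130613: given
S4, `SegmentOpen ↔ (UM → no isolated good point)`) with `uniformMarginality_of_uniformComplexBound`
(S4 ⊢ UM).  So the research residue of line `Sketch` is exactly: S4, and the unconditional
non-isolation of good points (perturbative linear universality at every Cardy point).  S4 is a
hypothesis (verbatim `stub_uniformComplexBound`), NOT claimed. -/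
theorem segmentOpen_iff_noIsolated_of_uniformComplexBound
    (h4 : ∀ t₀ : unitInterval, ∃ r > 0, ∀ R : ConformalRectangle, ∃ C : ℝ, ∀ δ : ℝ, 0 < δ →
      ∀ p : Polynomial ℝ,
        (∀ t : unitInterval, Percolation.cornerCrossingProb t R δ = p.eval (t : ℝ)) →
        ∀ z ∈ Metric.ball ((t₀ : ℝ) : ℂ) r, ‖(p.map (algebraMap ℝ ℂ)).eval z‖ ≤ C) :
    Summit.CriticalPhenomena.CardyFormulaZ2.Theses.CardySelfDualSegment.SegmentOpen ↔
      ∀ t₀ ∈ {t : unitInterval | ∃ α : ℂ, 0 < α.im ∧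
          ∀ (R R' : ConformalRectangle)
            (φ : ConformalEquiv UpperHalfPlane.upperHalfPlaneSet R.carrier) (x : Fin 4 → ℝ),
            R.carrier = moduliShear α '' R'.carrier → (∀ i, R.pt i = moduliShear α (R'.pt i)) →
            R.IsUniformizing φ x →
            Tendsto (Percolation.cornerCrossingProb t R') (𝓝[>] 0)
              (𝓝 (RandomPlanarGeometry.cardyFunction (RandomPlanarGeometry.crossRatio x)))},
        AccPt t₀ (𝓟 {t : unitInterval | ∃ α : ℂ, 0 < α.im ∧
          ∀ (R R' : ConformalRectangle)
            (φ : ConformalEquiv UpperHalfPlane.upperHalfPlaneSet R.carrier) (x : Fin 4 → ℝ),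
            R.carrier = moduliShear α '' R'.carrier → (∀ i, R.pt i = moduliShear α (R'.pt i)) →
            R.IsUniformizing φ x →
            Tendsto (Percolation.cornerCrossingProb t R') (𝓝[>] 0)
              (𝓝 (RandomPlanarGeometry.cardyFunction (RandomPlanarGeometry.crossRatio x)))}) := by
  rw [stub_segmentOpen_iff_noIsolatedGoodPoint h4]
  have hUM := uniformMarginalityShape_of_uniformComplexBound h4
  exact ⟨fun h => h hUM, fun h _ => h⟩

end Summit.CriticalPhenomena.CardyFormulaZ2.Theorems
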